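import Summits.QuantumFields.YangMills.Theorems.BalabanUVNodesN11FirstTStepO3OfIntrinsicReading

/-!
# DAG node N11 — THEOREM 1 OF [III] AT LEVEL 1 (`ρ₁` has the (2.18) form at every history of length 1) FROM THE FIRST-STEP TERM DATA, ITS BOUNDS, AND ONE A.E. IDENTITY OF
# CONDITIONAL EXPECTATIONS PER 𝐓-PRESENT HISTORY — the first rung of Theorem 1's induction with [I] Thm 1 + [II] displayed as (hce), nothing charted

HEADER — WORK-UNIT METADATA.  Cell `pub-ymgap`, YM-PLAN Track A (HUMAN RULING D-0062), seat `pub-ymgap-dag-n11-d` (g16; R134 fan-out base seat N11 [B14], strategy s2),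
route `BalabanUVNodes`, item K1⁹ `StabilityBRunRowsAtRecordR13SepCoPHV` = stmt-QuantumFields-27364 (helper lane, `--kind proof --supports 27364 --as helper`, count-neutral).
[I] = [Balaban1987RG1], [II] = [Balaban1988RG2Cluster], [III] = [Balaban1988Convergent], [IV] = [Balaban1989LargeFieldI].  Composition of this seat's
`…FirstTStepO3OfIntrinsicReading` (`firstStepClausesAt_of_bounds_of_condExpRho_of_provisos`: dag-n11-e's `FirstStepClausesAt θ p s u₁ e₁` at a 𝐓-present history of length 1
from the core provisos, rows, clauses (i)–(ii) and (hce)) with dag-n11-e ∕ this seat's `…SupplyChainFirstLink.sLaw₁₃CoPH_one_of_firstStepClauses` (Theorem 1 at level 1 on the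
live-selector line from first-step data) and `…SupplyChainBaseConstant.noExpansionClauseFor_zero_baseWitness_of_noExpansionTStepAt` (the level-0 no-expansion clause of the
base witness from the -d lane's `NoExpansionTStepAt θ p 0`).

WHY THIS FILE.  The first rung of Theorem 1's induction in ONE statement and the -d lane's final currency: `SLaw₁₃CoPH θ p 1` — «`ρ₁(s)` has the representation (2.18) with terms
obeying (2.25)–(2.42) at EVERY history `s` of length 1» — follows, on the live-selector line of a v1.7 parameter with the core provisos, from (a) first-step term values `u s` and
constants `E₁ s` that are universal in 𝐄 and satisfy the four level-1 𝐄-clauses, (b) at every 𝐓-PRESENT history (`Ω₁(s) ≠ ∅`, `𝐓ρ₀(s) ≢ 0`) r11's new-term clauses (i)–(ii)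
for `u s` (BOUNDS) and ONE a.e. identity (hce) «def-T's skew conditional expectation of `w(s)·ρ₀` = 11a's ζ-weighted `Y`-sum of A₀-integrals of `e^{A_1(s,Y; u s, E₁ s)}`»,
(c) the -d lane's level-0 no-expansion 𝐓-step `NoExpansionTStepAt θ p 0` (the 𝐓-ABSENT histories; a theorem of the rows at the lane's witnesses), and measurability rows.
(b) is [I] Thm 1 + [II] — the first renormalization transformation — as an identity of conditional expectations; nothing of it is proved here.

WHAT THIS FILE PROVES (0 `def`, 0 `sorry`, standard axioms).  ★★★ `sLaw₁₃CoPH_one_of_firstStepData_of_bounds_of_condExpRho`.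

HONEST FRAMING.  Helper lane of K1⁹; count-neutral; ONE composition BY NAME; (hbounds), (hce), `NoExpansionTStepAt θ p 0`, the 𝐄-clauses and the rows DISPLAYED; nothing of
Bałaban ([I] Thm 1, [II], [III] Thm 1–2) asserted; N11 NOT discharged; K1⁹ NOT closed, no registered stub touched; counts unmoved (typed 28∕28 · discharged 5∕27 · A 5∕28).  One
finite `𝕋⁴_{L^K}` programme at fixed `ε = L^{−K}`; R4 closes only the conditional finite-𝕋⁴ rung `BalabanLadder.UV` — NOT ℝ⁴, NOT OS, NOT a mass gap, NOT Clay.  No `sorry`,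
`axiom`, `def`, `instance`, `notation`.  Sources (SHAPE ∕ bookkeeping only): [III] Thm 1 p.262, Theorem p.245, Thm 2 p.263, §3 p.279, (3.1) p.264, (3.23)–(3.25) p.270,
(2.17)–(2.18) p.257, (2.25)–(2.31) pp.259–260, (2.41)–(2.42) p.261; [I] Thm 1 p.258, (0.4) p.253; [IV] (0.2)–(0.4) p.176, p.177 (i)–(ii).
-/

noncomputable section

open MeasureTheory ProbabilityTheory
open scoped ENNReal NNReal BigOperators Matrix.Norms.L2Operator

namespace Summit.QuantumFields.YangMills.Theorems.BalabanUVNodesN11FirstTStepSLawOneOfCondExp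

open Literature.MathematicalPhysics.QuantumFieldTheory.Balaban1983to89
open Literature.MathematicalPhysics.QuantumFieldTheory.Balaban1983to89.T4AveragingDisintegration
open BalabanUVNodesN11FirstTStepO3OfIntrinsicReading (firstStepClausesAt_of_bounds_of_condExpRho_of_provisos)
open BalabanUVNodesN11SupplyChainFirstLink (FirstStepClausesAt sLaw₁₃CoPH_one_of_firstStepClauses)
open BalabanUVNodesN11SupplyChainBaseConstant (noExpansionClauseFor_zero_baseWitness_of_noExpansionTStepAt)
open BalabanUVNodesN11Sect3SupplyDefs (NoExpansionTStepAt)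
open BalabanUVNodesN11Sect3SupplyChainDefs (NewEClausesAt)
open Node00 hiding SU
open Node00.Tk T4Continuum B14.Eq218Concrete
open B10Eq42TorusConstraint (bondsIn)

variable {F : T4Family} {N : ℕ} [NeZero N]

/-- ★★★ **THEOREM 1 OF [III] AT LEVEL 1 FROM THE FIRST-STEP TERM DATA, ITS BOUNDS, ONE A.E. IDENTITY PER 𝐓-PRESENT HISTORY, AND THE LEVEL-0 NO-EXPANSION 𝐓-STEP** (on the
live-selector line: core provisos, selector clause, admissibility, `0 ≤ κ, E₀, B₀`, `1 ≤ M`, `0 < K`).  See the module docstring.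
[cite: Balaban1988Convergent, Thm 1 p.262, Theorem p.245, Thm 2 p.263, §3 p.279, (3.1) p.264, (3.23)–(3.25) p.270; Balaban1987RG1, Thm 1 p.258; Balaban1989LargeFieldI, (0.2)–(0.4) p.176] -/
theorem sLaw₁₃CoPH_one_of_firstStepData_of_bounds_of_condExpRho (θ : Stage13HParams F N) (hP : θ.Provisos₁₃CoPH F N) (p : B12.RunParams)
    (hsel : θ.ppSel = ppSelLiveOfRecord F N θ.ν θ.τ9 (EOfRecord₁₃ F N θ.toStage13Params) (wOfRecord₉ F N θ.toStage9Params))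
    (hθ : θ.Admissible F N) (hκ : 0 ≤ θ.s2.lf.κ) (hE₀ : 0 ≤ θ.s2.lf.E₀) (hB₀ : 0 ≤ θ.s2.lf.B₀) (hM : 1 ≤ θ.τ9.M) (hK : 0 < p.K)
    -- (a) the first-step term data: universal in 𝐄, the four level-1 𝐄-clauses at every history
    (u : SeqOfRecord F θ.ν θ.τ9.M (gOfRecord₁₃ F N θ.toStage13Params p) p.K 1 → Sect2.TermValues (F.P p.K) (MatA N) (FluctV N) θ.τ9.M) (E₁ : SeqOfRecord F θ.ν θ.τ9.M (gOfRecord₁₃ F N θ.toStage13Params p) p.K 1 → ℝ)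
    (hu : Sect2.UniversalE u) (hOE : ∀ s : SeqOfRecord F θ.ν θ.τ9.M (gOfRecord₁₃ F N θ.toStage13Params p) p.K 1, NewEClausesAt θ p 0 (u s) s)
    -- measurability rows: the residual serving every history of length ≤ 1, the new operand at every history of length 1
    (hζm : ∀ n (s : SeqOfRecord F θ.ν θ.τ9.M (gOfRecord₁₃ F N θ.toStage13Params p) p.K n) j Y, Measurable ((θ.zhAt p s).ζ0 j Y))
    (hqm : ∀ n (s : SeqOfRecord F θ.ν θ.τ9.M (gOfRecord₁₃ F N θ.toStage13Params p) p.K n) j Λ', Measurable ((θ.zhAt p s).quad j Λ'))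
    (hΦm : ∀ (s' : SeqOfRecord F θ.ν θ.τ9.M (gOfRecord₁₃ F N θ.toStage13Params p) p.K 1), ∀ S ∈ admSOfRecord F θ.ν θ.τ9.M (gOfRecord₁₃ F N θ.toStage13Params p) p.K 1 s',
      Measurable fun ω : MultiCfg (F.P p.K) (SU N) (FluctV N) =>
        (sect2Operand F N (FluctV N) p.K (settingOfRecord₁₃ F N θ.toStage13Params p) (θ.rzAt p s') s' (u s') (E₁ s')
                  (UbgOfRecord₁₃CoP F N θ.toStage13Params p 1 s')) (S, fun j => (ω j).2) (fun j => (ω j).1))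
    -- (b) at every 𝐓-present history: r11's new-term clauses (i)–(ii) for `u s` …
    (hbounds : ∀ s' : SeqOfRecord F θ.ν θ.τ9.M (gOfRecord₁₃ F N θ.toStage13Params p) p.K 1, s'.Ω 1 ≠ ∅ →
      slotsTOfRecord F N θ.ν θ.τ9 (EOfRecord₁₃ F N θ.toStage13Params) (wOfRecord₉ F N θ.toStage9Params) θ.ppSel p (gOfRecord₁₃ F N θ.toStage13Params p) 1 s' ≠ 0 →
      Step.LFNewTerms (sect2TowerOfRecord F N (FluctV N) p.K (settingOfRecord₁₃ F N θ.toStage13Params p) (θ.rzAt p s') s' (u s')) (settingOfRecord₁₃ F N θ.toStage13Params p).lf (settingOfRecord₁₃ F N θ.toStage13Params p).βc 0 ∧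
      (∀ (X : (Sect2.domSys (F.P p.K) θ.τ9.M 1).Dom) (z : Site (F.P p.K) 1) (g : ℝ), 0 ≤ g → g ≤ (settingOfRecord₁₃ F N θ.toStage13Params p).lf.γ →
        AnalyticOnNhd ℂ ((u s').E 1 X z g) ((sect2TowerOfRecord F N (FluctV N) p.K (settingOfRecord₁₃ F N θ.toStage13Params p) (θ.rzAt p s') s' (u s')).space 1 X ((settingOfRecord₁₃ F N θ.toStage13Params p).lf.alpha0 ((settingOfRecord₁₃ F N θ.toStage13Params p).flow.g 1)) ((settingOfRecord₁₃ F N θ.toStage13Params p).lf.alpha1 ((settingOfRecord₁₃ F N θ.toStage13Params p).flow.g 1)))) ∧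
      (∀ X : (Sect2.domSys (F.P p.K) θ.τ9.M 1).Dom, AnalyticOnNhd ℂ ((u s').R 1 X) ((sect2TowerOfRecord F N (FluctV N) p.K (settingOfRecord₁₃ F N θ.toStage13Params p) (θ.rzAt p s') s' (u s')).space 1 X ((settingOfRecord₁₃ F N θ.toStage13Params p).lf.alpha0 ((settingOfRecord₁₃ F N θ.toStage13Params p).flow.g 1)) ((settingOfRecord₁₃ F N θ.toStage13Params p).lf.alpha1 ((settingOfRecord₁₃ F N θ.toStage13Params p).flow.g 1)))) ∧
      (∀ (X : (Sect2.domSys (F.P p.K) θ.τ9.M 1).Dom) (a : SFluct (F.P p.K) (FluctV N)), AnalyticOnNhd ℂ (fun φ => (u s').B 1 X φ a) ((sect2TowerOfRecord F N (FluctV N) p.K (settingOfRecord₁₃ F N θ.toStage13Params p) (θ.rzAt p s') s' (u s')).spaceB 1 X)))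
    -- … and ONE a.e. identity: def-T's skew conditional expectation of `w(s)·ρ₀` = 11a's ζ-weighted `Y`-sum of A₀-integrals of `e^{A_1(s, Y; u s, E₁ s)}`
    (hce : ∀ s' : SeqOfRecord F θ.ν θ.τ9.M (gOfRecord₁₃ F N θ.toStage13Params p) p.K 1, s'.Ω 1 ≠ ∅ →
      slotsTOfRecord F N θ.ν θ.τ9 (EOfRecord₁₃ F N θ.toStage13Params) (wOfRecord₉ F N θ.toStage9Params) θ.ppSel p (gOfRecord₁₃ F N θ.toStage13Params p) 1 s' ≠ 0 →
      kernelTransport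
        ((Measure.pi fun _ : ↥(Set.toFinite (bondsIn 0 (s'.Ω 1)ᶜ)).toFinset => (HaarData.haar : Measure (SU N))).prod
          (Measure.pi fun _ : {b : PBond (F.P p.K) 0 // b ∉ (Set.toFinite (bondsIn 0 (s'.Ω 1)ᶜ)).toFinset} => (HaarData.haar : Measure (SU N))))
        ((Measure.pi fun _ : ↥(Set.toFinite (bondsIn 0 (s'.Ω 1)ᶜ)).toFinset => (HaarData.haar : Measure (SU N))).prod
          (Measure.pi fun _ : {c : PBond (F.P p.K) 1 // c ∉ (Set.toFinite (bondsIn 1 (s'.Ω 1)ᶜ)).toFinset} => (HaarData.haar : Measure (SU N))))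
        (fun q => (q.1, fun c : {c : PBond (F.P p.K) 1 // c ∉ (Set.toFinite (bondsIn 1 (s'.Ω 1)ᶜ)).toFinset} =>
          (avOfRecord F N p.K 0).avg
            ((MeasurableEquiv.piEquivPiSubtypeProd (fun _ : PBond (F.P p.K) 0 => SU N) (· ∈ (Set.toFinite (bondsIn 0 (s'.Ω 1)ᶜ)).toFinset)).symm q) c))
        ((fun U => wOfRecord₉ F N θ.toStage9Params p (gOfRecord₁₃ F N θ.toStage13Params p) 0 s' U ((avOfRecord F N p.K 0).avg U) *
            slotsOfRecord F N θ.ν θ.τ9 (EOfRecord₁₃ F N θ.toStage13Params) (wOfRecord₉ F N θ.toStage9Params) θ.ppSel p (gOfRecord₁₃ F N θ.toStage13Params p) 0 s'.init U) ∘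
          ⇑(MeasurableEquiv.piEquivPiSubtypeProd (fun _ : PBond (F.P p.K) 0 => SU N) (· ∈ (Set.toFinite (bondsIn 0 (s'.Ω 1)ᶜ)).toFinset)).symm)
      =ᵐ[((Measure.pi fun _ : ↥(Set.toFinite (bondsIn 0 (s'.Ω 1)ᶜ)).toFinset => (HaarData.haar : Measure (SU N))).prod
          (Measure.pi fun _ : {c : PBond (F.P p.K) 1 // c ∉ (Set.toFinite (bondsIn 1 (s'.Ω 1)ᶜ)).toFinset} => (HaarData.haar : Measure (SU N))))]
        fun z => ∑ Y ∈ (Set.toFinite {Y : Set (Site (F.P p.K) 0) | Y ∈ SClassOfRecord F θ.ν (gOfRecord₁₃ F N θ.toStage13Params p) p.K 1 ∧ Y ⊆ s'.Ω 1 ∩ (s'.Λ 1)ᶜ}).toFinset,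
          zetaOp (genDataOfRecord F N (FluctV N) θ.ν θ.τ9.M (gOfRecord₁₃ F N θ.toStage13Params p) p.K (WtOfRecord₁₃H F N θ p s') s' (Function.update (fun _ => ∅) 1 Y) 0).ζ
            (aOp 0 (genDataOfRecord F N (FluctV N) θ.ν θ.τ9.M (gOfRecord₁₃ F N θ.toStage13Params p) p.K (WtOfRecord₁₃H F N θ p s') s' (Function.update (fun _ => ∅) 1 Y) 0).sA
              (genDataOfRecord F N (FluctV N) θ.ν θ.τ9.M (gOfRecord₁₃ F N θ.toStage13Params p) p.K (WtOfRecord₁₃H F N θ p s') s' (Function.update (fun _ => ∅) 1 Y) 0).w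
              (fun ω => (sect2Operand F N (FluctV N) p.K (settingOfRecord₁₃ F N θ.toStage13Params p) (θ.rzAt p s') s' (u s') (E₁ s')
                  (UbgOfRecord₁₃CoP F N θ.toStage13Params p 1 s')) (Function.update (fun _ => ∅) 1 Y, fun j => (ω j).2) (fun j => (ω j).1)))
            (Function.update (baseCfg 1 ((MeasurableEquiv.piEquivPiSubtypeProd (fun _ : PBond (F.P p.K) 1 => SU N)
              (· ∈ (Set.toFinite (bondsIn 1 (s'.Ω 1)ᶜ)).toFinset)).symm (avgRestrOfRecord F N p.K 0 (Set.toFinite (bondsIn 0 (s'.Ω 1)ᶜ)).toFinset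
                (Set.toFinite (bondsIn 1 (s'.Ω 1)ᶜ)).toFinset z.1, z.2))) 0
            (Function.updateFinset ((baseCfg (V := FluctV N) 1 ((MeasurableEquiv.piEquivPiSubtypeProd (fun _ : PBond (F.P p.K) 1 => SU N)
              (· ∈ (Set.toFinite (bondsIn 1 (s'.Ω 1)ᶜ)).toFinset)).symm (avgRestrOfRecord F N p.K 0 (Set.toFinite (bondsIn 0 (s'.Ω 1)ᶜ)).toFinset
                (Set.toFinite (bondsIn 1 (s'.Ω 1)ᶜ)).toFinset z.1, z.2))) 0).1 (Set.toFinite (bondsIn 0 (s'.Ω 1)ᶜ)).toFinset z.1,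
              ((baseCfg (V := FluctV N) 1 ((MeasurableEquiv.piEquivPiSubtypeProd (fun _ : PBond (F.P p.K) 1 => SU N)
              (· ∈ (Set.toFinite (bondsIn 1 (s'.Ω 1)ᶜ)).toFinset)).symm (avgRestrOfRecord F N p.K 0 (Set.toFinite (bondsIn 0 (s'.Ω 1)ᶜ)).toFinset
                (Set.toFinite (bondsIn 1 (s'.Ω 1)ᶜ)).toFinset z.1, z.2))) 0).2)))
    -- (c) the level-0 no-expansion 𝐓-step (the 𝐓-absent histories)
    (hT0 : NoExpansionTStepAt θ p 0) :
    SLaw₁₃CoPH F N θ p 1 :=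
  sLaw₁₃CoPH_one_of_firstStepClauses θ p hP hsel hθ hκ hE₀ hB₀ hM hK u E₁ hu hOE
    (fun s' hΩ hT =>
      have hb := hbounds s' hΩ hT
      firstStepClausesAt_of_bounds_of_condExpRho_of_provisos θ hP p hK s' (u s') (E₁ s') (hζm _ _) (hqm _ _) (hζm _ _) (hqm _ _) (hΦm s')
        (hce s' hΩ hT) hb.1 hb.2.1 hb.2.2.1 hb.2.2.2)
    (noExpansionClauseFor_zero_baseWitness_of_noExpansionTStepAt θ p hM hT0)

end Summit.QuantumFields.YangMills.Theorems.BalabanUVNodesN11FirstTStepSLawOneOfCondExp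

end
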